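import Literature.NumberTheory.Sieve.BombieriVinogradovReduction
import Summits.Parity.GeneralizedHardyLittlewood.Theorems.BeyondDiagonalBeatsQuarter.OffDiagFlatnessCount
import HarnessLib

/-!
# Route `PrimeLevelFamEdge`, crux K_B (stmt-Parity-20343), line `diagonal_kernel_split` rev 4, plan Ω,
# `OffDiagCoreTallCount` (line lead 2026-08-28T17:02:08Z (2)), stage 1: **the arithmetic of the TALL-moduli principal
# terms — `Σ_{n ≤ H} τ(n)/φ(n) ≤ (1 + log H)⁴` and `Σ_{n ≤ H} φ(n)⁻¹·Σ_{m ≤ A} gcd(m,n) ≤ A·(1 + log H)⁴`**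

prover-5's FINDING (2026-08-28T16:52:24Z, adopted by the line lead 17:02:08Z): for a unit dual modulus `h₁` with
`n₀ = |h₁|/gcd(ab, h₁)` the `s`-sum of the principal parts of the class counts is COPRIME-restricted, so after Möbius
on `(s′, n₀) = 1` and Poisson per sublattice the principal part of the dual box series at the modulus `h₁` is
`P(h₁) = φ(n₀)⁻¹ Σ_q Σ_{m ∈ box} c_{n₀}(m)·e(∓τ_q m)·𝓕₁Φ_q(ξ_q; m)` with RAMANUJAN coefficients `c_{n₀}(m)`,
`|c_n(m)| ≤ gcd(n, m)`; for TALL moduli `n₀ ≥ 2^{i₂+1}` the complete-sum term vanishes (E14) but the sublattice samples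
do not, and summed over `2^{i₂+1} ≤ |h₁| ≤ H₁` with absolute values they carry `≈ U × L` (the row «a8P-TALL», same
quasi-RH class as the short-moduli transition piece). The line lead asked for that trivial mass as a KERNEL number in
`ms`-currency. This file is stage 1 — the `h₁`-arithmetic, free of K_B objects (stage 2 threads it through the layer sum
`Σ_{r,l,m,d,i} |c_l c_m|·(4πq̂/q)·…` once `OffDiagPrincipalCoprime`/`…Sublattice`/`OffDiagCoreSplit.coreP` expose the
tall principal object by name):

* `sum_card_divisors_mul_totient_inv_le` — `Σ_{n ≤ H} τ(n)/φ(n) ≤ (1 + log H)⁴` (`τ(n)/φ(n) = Σ_{g ∣ n} 1/φ(n)`, exchange,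
  `Σ_{n ≤ H, g ∣ n} 1/φ(n) ≤ W(H)/φ(g)` and `W(H) = Σ_{g ≤ H} 1/φ(g) ≤ (1 + log H)²` from the tree's
  `Literature.NumberTheory.Sieve.sum_filter_dvd_totient_inv_le` / `totientInvSum_le`); no lower bound for `φ` is used;
* **`sum_totient_inv_mul_sum_gcd_le`** — `Σ_{n ≤ H} φ(n)⁻¹·Σ_{m ≤ A} gcd(m, n) ≤ A·(1 + log H)⁴`
  (`Σ_{m ≤ A} gcd(m,n) ≤ τ(n)·A`, `OffDiagFlatnessCount.sum_Icc_gcd_le`) — with `|c_n(m)| ≤ gcd(n,m)` this is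
  «`Σ_{tall n} φ(n)⁻¹ Σ_{m ∈ box} |c_n(m)| ≤ |box|·(1 + log H₁)⁴`»: prover-5's `2^{ω(n₀)}` and `log(H₁/2K₂)` factors
  priced together as `(1 + log H₁)⁴`;
* `sum_totient_inv_mul_sum_gcd_mul_le` — the weighted form: `0 ≤ g(n,m) ≤ S` ⇒
  `Σ_{n ∈ 𝓝} φ(n)⁻¹ Σ_{m ≤ A} gcd(m,n)·g(n,m) ≤ S·A·(1 + log H)⁴` for any `𝓝 ⊆ [1, H]` (the tall range
  `[2^{i₂+1}, H₁]`, the size `S = sup|𝓕₁Φ|·#levels`, …), and `…_sub_le` for a box `m ∈ (A₀, A₀ + A] ⊆ [1, A₀ + A]`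
  bounded through `[1, A₀ + A]`.
Pure arithmetic; no def; helper toward `stub_offDiagBelowSlack_io` (`--supports stmt-Parity-20343`); closes nothing;
standard axioms.
«The programme SEARCHES and TYPES; no claim about Landau–Siegel zeros, Theorems 1–2 of arXiv:2211.02515 or
a repaired Margin232 until a kernel theorem says so.»
-/

noncomputable section

namespace Summit.Parity.GeneralizedHardyLittlewood.Theorems.BeyondDiagonalBeatsQuarter.OffDiag

open Finset
open Literature.NumberTheory.Sieve (totientInvSum totientInvSum_le sum_filter_dvd_totient_inv_le)

/-! ### §1. `Σ_{n ≤ H} τ(n)/φ(n) ≤ (1 + log H)⁴` -/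

/-- `τ(n)/φ(n)` summed: `Σ_{n ≤ H} τ(n)/φ(n) ≤ W(H)²`, `W(H) = Σ_{g ≤ H} 1/φ(g)` (exchange the divisor sum and use
`Σ_{n ≤ H, g ∣ n} 1/φ(n) ≤ W(H)/φ(g)`). [folklore] -/
theorem sum_card_divisors_mul_totient_inv_le_sq (H : ℕ) :
    ∑ n ∈ Icc 1 H, (n.divisors.card : ℝ) * ((Nat.totient n : ℝ))⁻¹ ≤ totientInvSum H ^ 2 := by
  classical
  -- `τ(n)·φ(n)⁻¹ = Σ_{g ∈ divisors n} φ(n)⁻¹`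
  have h1 : ∀ n ∈ Icc 1 H, (n.divisors.card : ℝ) * ((Nat.totient n : ℝ))⁻¹ =
      ∑ g ∈ n.divisors, ((Nat.totient n : ℝ))⁻¹ := by
    intro n _
    rw [Finset.sum_const, nsmul_eq_mul]
  rw [Finset.sum_congr rfl h1]
  -- exchange: `Σ_{n ≤ H} Σ_{g ∣ n} = Σ_{g ≤ H} Σ_{n ≤ H, g ∣ n}`
  rw [Finset.sum_comm' (t' := Icc 1 H) (s' := fun g => (Icc 1 H).filter (fun n => g ∣ n))]
  · calc ∑ g ∈ Icc 1 H, ∑ n ∈ (Icc 1 H).filter (fun n => g ∣ n), ((Nat.totient n : ℝ))⁻¹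
        ≤ ∑ g ∈ Icc 1 H, ((Nat.totient g : ℝ))⁻¹ * totientInvSum H :=
          Finset.sum_le_sum fun g hg => sum_filter_dvd_totient_inv_le H (Finset.mem_Icc.1 hg).1
      _ = totientInvSum H ^ 2 := by rw [← Finset.sum_mul, totientInvSum, sq]
  · intro n g
    simp only [Finset.mem_filter, Finset.mem_Icc, Nat.mem_divisors]
    constructor
    · rintro ⟨⟨h1n, hnH⟩, hgn, hn0⟩
      refine ⟨⟨⟨h1n, hnH⟩, hgn⟩, ?_, ?_⟩
      · exact Nat.pos_of_ne_zero fun hg0 => hn0 (Nat.eq_zero_of_zero_dvd (hg0 ▸ hgn))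
      · exact (Nat.le_of_dvd (by omega) hgn).trans hnH
    · rintro ⟨⟨⟨h1n, hnH⟩, hgn⟩, -, -⟩
      exact ⟨⟨h1n, hnH⟩, hgn, by omega⟩

/-- **`Σ_{n ≤ H} τ(n)/φ(n) ≤ (1 + log H)⁴`** (`W(H) ≤ (1 + log H)²`). [folklore] -/
theorem sum_card_divisors_mul_totient_inv_le (H : ℕ) :
    ∑ n ∈ Icc 1 H, (n.divisors.card : ℝ) * ((Nat.totient n : ℝ))⁻¹ ≤ (1 + Real.log H) ^ 4 := by
  have hW0 : 0 ≤ totientInvSum H := Finset.sum_nonneg fun _ _ => inv_nonneg.2 (Nat.cast_nonneg _)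
  calc ∑ n ∈ Icc 1 H, (n.divisors.card : ℝ) * ((Nat.totient n : ℝ))⁻¹ ≤ totientInvSum H ^ 2 :=
        sum_card_divisors_mul_totient_inv_le_sq H
    _ ≤ ((1 + Real.log H) ^ 2) ^ 2 := pow_le_pow_left₀ hW0 (totientInvSum_le H) 2
    _ = (1 + Real.log H) ^ 4 := by ring

/-! ### §2. The `gcd`-weighted count over the moduli: `Σ_{n ≤ H} φ(n)⁻¹ Σ_{m ≤ A} gcd(m,n) ≤ A·(1 + log H)⁴` -/

/-- **The tall-moduli Ramanujan mass, arithmetic form**: `Σ_{n ≤ H} φ(n)⁻¹·Σ_{m ≤ A} gcd(m, n) ≤ A·(1 + log H)⁴`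
(`Σ_{m ≤ A} gcd(m,n) ≤ τ(n)·A` and §1). With `|c_n(m)| ≤ gcd(n,m)` for the Ramanujan sums this prices
`Σ_n φ(n)⁻¹ Σ_{m ∈ box} |c_n(m)|` by `|box|·(1 + log H)⁴`. [folklore] -/
theorem sum_totient_inv_mul_sum_gcd_le (H A : ℕ) :
    ∑ n ∈ Icc 1 H, ((Nat.totient n : ℝ))⁻¹ * ∑ m ∈ Icc 1 A, (Nat.gcd m n : ℝ) ≤ (A : ℝ) * (1 + Real.log H) ^ 4 := by
  calc ∑ n ∈ Icc 1 H, ((Nat.totient n : ℝ))⁻¹ * ∑ m ∈ Icc 1 A, (Nat.gcd m n : ℝ)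
      ≤ ∑ n ∈ Icc 1 H, ((Nat.totient n : ℝ))⁻¹ * ((n.divisors.card : ℝ) * A) := by
        refine Finset.sum_le_sum fun n hn => mul_le_mul_of_nonneg_left ?_ (inv_nonneg.2 (Nat.cast_nonneg _))
        exact_mod_cast sum_Icc_gcd_le (Finset.mem_Icc.1 hn).1 A
    _ = (A : ℝ) * ∑ n ∈ Icc 1 H, (n.divisors.card : ℝ) * ((Nat.totient n : ℝ))⁻¹ := by
        rw [Finset.mul_sum]
        exact Finset.sum_congr rfl fun n _ => by ring
    _ ≤ (A : ℝ) * (1 + Real.log H) ^ 4 :=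
        mul_le_mul_of_nonneg_left (sum_card_divisors_mul_totient_inv_le H) (Nat.cast_nonneg A)

/-- **Weighted form over a sub-range of moduli**: for `𝓝 ⊆ [1, H]` (e.g. the tall moduli `[2^{i₂+1}, H₁]`) and weights
`0 ≤ g(n, m) ≤ S`: `Σ_{n ∈ 𝓝} φ(n)⁻¹·Σ_{m ≤ A} gcd(m,n)·g(n,m) ≤ S·A·(1 + log H)⁴`. [folklore] -/
theorem sum_totient_inv_mul_sum_gcd_mul_le {H A : ℕ} {𝓝 : Finset ℕ} (h𝓝 : 𝓝 ⊆ Icc 1 H) {S : ℝ} (hS : 0 ≤ S)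
    (g : ℕ → ℕ → ℝ) (hg : ∀ n ∈ 𝓝, ∀ m ∈ Icc 1 A, 0 ≤ g n m ∧ g n m ≤ S) :
    ∑ n ∈ 𝓝, ((Nat.totient n : ℝ))⁻¹ * ∑ m ∈ Icc 1 A, (Nat.gcd m n : ℝ) * g n m ≤
      S * (A : ℝ) * (1 + Real.log H) ^ 4 := by
  have hφ : ∀ n, 0 ≤ ((Nat.totient n : ℝ))⁻¹ := fun n => inv_nonneg.2 (Nat.cast_nonneg _)
  calc ∑ n ∈ 𝓝, ((Nat.totient n : ℝ))⁻¹ * ∑ m ∈ Icc 1 A, (Nat.gcd m n : ℝ) * g n m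
      ≤ ∑ n ∈ 𝓝, ((Nat.totient n : ℝ))⁻¹ * (S * ∑ m ∈ Icc 1 A, (Nat.gcd m n : ℝ)) := by
        refine Finset.sum_le_sum fun n hn => mul_le_mul_of_nonneg_left ?_ (hφ n)
        rw [Finset.mul_sum]
        refine Finset.sum_le_sum fun m hm => ?_
        rw [mul_comm S]
        exact mul_le_mul_of_nonneg_left (hg n hn m hm).2 (Nat.cast_nonneg _)
    _ = S * ∑ n ∈ 𝓝, ((Nat.totient n : ℝ))⁻¹ * ∑ m ∈ Icc 1 A, (Nat.gcd m n : ℝ) := by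
        rw [Finset.mul_sum]
        exact Finset.sum_congr rfl fun n _ => by ring
    _ ≤ S * ∑ n ∈ Icc 1 H, ((Nat.totient n : ℝ))⁻¹ * ∑ m ∈ Icc 1 A, (Nat.gcd m n : ℝ) := by
        refine mul_le_mul_of_nonneg_left (Finset.sum_le_sum_of_subset_of_nonneg h𝓝 fun n _ _ => ?_) hS
        exact mul_nonneg (hφ n) (Finset.sum_nonneg fun m _ => Nat.cast_nonneg _)
    _ ≤ S * ((A : ℝ) * (1 + Real.log H) ^ 4) :=
        mul_le_mul_of_nonneg_left (sum_totient_inv_mul_sum_gcd_le H A) hS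
    _ = S * (A : ℝ) * (1 + Real.log H) ^ 4 := by ring

/-- **Box form**: for a window of second coordinates `m ∈ 𝓜 ⊆ [1, A]` (a dyadic box `(2^{i₂}/2, 2^{i₂+1})` has
`A = 2^{i₂+1}`), moduli `𝓝 ⊆ [1, H]` and weights `0 ≤ g ≤ S`:
`Σ_{n ∈ 𝓝} φ(n)⁻¹·Σ_{m ∈ 𝓜} gcd(m,n)·g(n,m) ≤ S·A·(1 + log H)⁴`. [folklore] -/
theorem sum_totient_inv_mul_sum_gcd_mul_le_of_subset {H A : ℕ} {𝓝 𝓜 : Finset ℕ} (h𝓝 : 𝓝 ⊆ Icc 1 H)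
    (h𝓜 : 𝓜 ⊆ Icc 1 A) {S : ℝ} (hS : 0 ≤ S) (g : ℕ → ℕ → ℝ) (hg : ∀ n ∈ 𝓝, ∀ m ∈ 𝓜, 0 ≤ g n m ∧ g n m ≤ S) :
    ∑ n ∈ 𝓝, ((Nat.totient n : ℝ))⁻¹ * ∑ m ∈ 𝓜, (Nat.gcd m n : ℝ) * g n m ≤
      S * (A : ℝ) * (1 + Real.log H) ^ 4 := by
  classical
  -- extend `g` by `0` off the window
  set g' : ℕ → ℕ → ℝ := fun n m => if m ∈ 𝓜 then g n m else 0 with hg'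
  have hg'b : ∀ n ∈ 𝓝, ∀ m ∈ Icc 1 A, 0 ≤ g' n m ∧ g' n m ≤ S := by
    intro n hn m _
    simp only [hg']
    split_ifs with hm
    · exact hg n hn m hm
    · exact ⟨le_rfl, hS⟩
  have hin : ∀ n ∈ 𝓝, ∑ m ∈ 𝓜, (Nat.gcd m n : ℝ) * g n m = ∑ m ∈ Icc 1 A, (Nat.gcd m n : ℝ) * g' n m := by
    intro n _
    rw [← Finset.sum_subset h𝓜 (f := fun m => (Nat.gcd m n : ℝ) * g' n m)]
    · exact Finset.sum_congr rfl fun m hm => by simp only [hg', if_pos hm]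
    · intro m _ hm
      simp only [hg', if_neg hm, mul_zero]
  rw [Finset.sum_congr rfl fun n hn => by rw [hin n hn]]
  exact sum_totient_inv_mul_sum_gcd_mul_le h𝓝 hS g' hg'b

end Summit.Parity.GeneralizedHardyLittlewood.Theorems.BeyondDiagonalBeatsQuarter.OffDiag
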